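import Summits.ValiantsHypothesis.ValiantsHypothesis.Theorems.GeneratorObstructionsPerGenDegreeSuperQPBiCollapsedPermanentRays
import Mathlib.RingTheory.RootsOfUnity.Complex

/-!
# Route GeneratorObstructions — K1 `PerGenDegreeSuperQP` (stmt-ValiantsHypothesis-11654),
# line `per-side-atoms`: the MODULAR COLLAPSE `Q_{m,j} = per_m(x_{ik} ↦ y_{(i+k) mod j})`
# — the form, its support, and its separating root-of-unity torus

Support file of the line (occupancy of the occurrence monoid `S(per_m)`). The earlier catalogue
of hit chamber rays `(1^j)^*` consists of the PRODUCTS `j = r₁ r₂` (`…BiCollapsedPermanentRays`)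
and SUMS `j = r + p` (`…TwoMonomialsRay`) of two divisors of `m`, plus `j ≤ 4` (`…BinaryFermatRays`);
for `m` prime this is `{1, 2, 3, 4, m, m+1, 2m, m²}` and every other `j` was open. This file and
its sequels (`…ModularCollapseCone`, `…ModularCollapseRays`) hit EVERY SHORT RAY `1 ≤ j ≤ m`
at once, by one new polystable degeneration of the permanent:

  `Q_{m,j} := per_m(x_{ik} ↦ y_{(i + k) mod j}) = ∑_σ ∏_i y_{(σ(i) + i) mod j}`,

a form of degree `m` in the `j` variables `y_0, …, y_{j-1}` (all of which occur once `j ≤ m`).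
Contents of this file (pure bookkeeping, pattern of `…CollapsedPermanent`):
* `modCollapse_eq_sum`, `coeff_modCollapse`, `mem_support_modCollapse_iff`,
  `modCollapse_isHomogeneous`, `modCollapse_ne_zero` — the form, its coefficients (numbers of
  permutations with a given residue content `e_σ = ∑_i ε_{(σ i + i) mod j}`), its support;
* `linSubst_diagonal_modCollapse_eq` — diagonal substitutions with `∏_i d_{(σ i + i) mod j} = 1`
  for all `σ` fix `Q_{m,j}`;
* `sum_val_label_modEq` — the residue content of every monomial has total INDEX SUM
  `≡ m(m-1) (mod j)` (indeed `∑_i (σ i + i) = m(m-1)`);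
* `modCollapse_separating` — hypothesis (1') of the corrected BI 2017 Prop. 2.8: the torus
  element `d_r = ζ^r · ζ^{-(m-1)}` (`ζ = e^{2πi/j}`) fixes `Q_{m,j}` (by the index-sum congruence)
  and separates any two variables (`ζ` is a PRIMITIVE `j`-th root of unity).
The positive-cone hypothesis (2) — `(1,…,1)` in the relative interior of the cone of the support —
is NOT available with uniform weights here (the integer residue counts are flat only if `j ∣ m²`);
it is established in `…ModularCollapseCone` by a flat strictly positive coupling and
Birkhoff–von Neumann. Honest framing: unconditional structure (occupancy) theorems;
`stub_atomLate` (`c ≥ 2`), K1 and `GenFlipThesis` remain OPEN; first-occurrence DEGREES on the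
rays are untouched; nothing here bears on VP versus VNP.
References: [BurgisserIkenmeyer2017] Prop. 2.8 (corrected, tree erratum A31), Cor. 2.9, Def. 3.3;
[MulmuleySohoni2001] §4.
-/

set_option linter.dupNamespace false

noncomputable section

namespace Summit.ValiantsHypothesis.ValiantsHypothesis.Theorems.GeneratorObstructions.PerGenDegreeSuperQP

open MvPolynomial
open Literature.NumberTheory.DiophantineGeometry Literature.Computability.AlgebraicComplexity
  Literature.Computability.Complexity

/-! ### 1. The modular collapse `Q_{m,j}` on `j` variables -/

section ModCollapse

variable {m j : ℕ} [NeZero j]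

/-- **The modular collapse as a sum over permutations**:
`Q_{m,j} = per_m(x_{ik} ↦ y_{(i+k) mod j}) = ∑_σ ∏_i y_{(σ i + i) mod j}`. [folklore] -/
theorem modCollapse_eq_sum :
    MvPolynomial.rename
        (fun ik : Fin m × Fin m => Fin.ofNat j (ik.1 : ℕ) + Fin.ofNat j (ik.2 : ℕ))
        (perPoly (Fin m) ℂ) =
      ∑ σ : Equiv.Perm (Fin m), ∏ i : Fin m,
        X (Fin.ofNat j ((σ i : Fin m) : ℕ) + Fin.ofNat j (i : ℕ)) := by
  rw [perPoly_eq_sum_prod, map_sum]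
  simp only [map_prod, rename_X]

/-- The `σ`-th product of variables of `Q_{m,j}` is the monomial with exponent the RESIDUE
CONTENT `e_σ = ∑_i ε_{(σ i + i) mod j}`. [folklore] -/
theorem prod_X_eq_monomial_sum_single_mod (σ : Equiv.Perm (Fin m)) :
    (∏ i : Fin m, X (Fin.ofNat j ((σ i : Fin m) : ℕ) + Fin.ofNat j (i : ℕ)) :
        MvPolynomial (Fin j) ℂ) =
      monomial (∑ i : Fin m,
        Finsupp.single (Fin.ofNat j ((σ i : Fin m) : ℕ) + Fin.ofNat j (i : ℕ)) 1) 1 := by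
  rw [monomial_sum_one]
  rfl

/-- **Coefficients of the modular collapse count permutations**: the coefficient of `α` in
`Q_{m,j}` is the number of `σ` with residue content `e_σ = α`. [folklore] -/
theorem coeff_modCollapse (α : Fin j →₀ ℕ) :
    coeff α (MvPolynomial.rename
        (fun ik : Fin m × Fin m => Fin.ofNat j (ik.1 : ℕ) + Fin.ofNat j (ik.2 : ℕ))
        (perPoly (Fin m) ℂ)) =
      ((Finset.univ.filter fun σ : Equiv.Perm (Fin m) =>
        (∑ i : Fin m,
          Finsupp.single (Fin.ofNat j ((σ i : Fin m) : ℕ) + Fin.ofNat j (i : ℕ)) 1) = α).card : ℂ) := by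
  classical
  rw [modCollapse_eq_sum, coeff_sum]
  simp only [prod_X_eq_monomial_sum_single_mod, coeff_monomial, Finset.sum_boole]

/-- The support of the modular collapse is exactly the set of residue contents `e_σ` (positive
integer coefficients: no cancellation). [folklore] -/
theorem mem_support_modCollapse_iff (α : Fin j →₀ ℕ) :
    α ∈ (MvPolynomial.rename
        (fun ik : Fin m × Fin m => Fin.ofNat j (ik.1 : ℕ) + Fin.ofNat j (ik.2 : ℕ))
        (perPoly (Fin m) ℂ)).support ↔
      ∃ σ : Equiv.Perm (Fin m),
        (∑ i : Fin m,
          Finsupp.single (Fin.ofNat j ((σ i : Fin m) : ℕ) + Fin.ofNat j (i : ℕ)) 1) = α := by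
  classical
  rw [mem_support_iff, coeff_modCollapse, Nat.cast_ne_zero, ← Nat.pos_iff_ne_zero, Finset.card_pos,
    Finset.filter_nonempty_iff]
  simp

/-- The modular collapse is a form of degree `m`. [folklore] -/
theorem modCollapse_isHomogeneous :
    (MvPolynomial.rename
        (fun ik : Fin m × Fin m => Fin.ofNat j (ik.1 : ℕ) + Fin.ofNat j (ik.2 : ℕ))
        (perPoly (Fin m) ℂ)).IsHomogeneous m := by
  simpa [Fintype.card_fin] using
    (perPoly_isHomogeneous (n := Fin m) (k := ℂ)).rename_isHomogeneous
      (f := fun ik : Fin m × Fin m => Fin.ofNat j (ik.1 : ℕ) + Fin.ofNat j (ik.2 : ℕ))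

/-- The modular collapse is nonzero (the residue content `e_1` occurs). [folklore] -/
theorem modCollapse_ne_zero :
    MvPolynomial.rename
        (fun ik : Fin m × Fin m => Fin.ofNat j (ik.1 : ℕ) + Fin.ofNat j (ik.2 : ℕ))
        (perPoly (Fin m) ℂ) ≠ 0 := by
  intro h
  have hmem := (mem_support_modCollapse_iff (m := m) (j := j) _).mpr ⟨1, rfl⟩
  rw [h, support_zero] at hmem
  exact absurd hmem (Finset.notMem_empty _)

/-- **Diagonal substitutions fixing the modular collapse**: if `∏_i d((σ i + i) mod j) = 1` for
every permutation `σ`, then `diag(d)` fixes `Q_{m,j}`. [folklore] -/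
theorem linSubst_diagonal_modCollapse_eq (d : Fin j → ℂ)
    (hd : ∀ σ : Equiv.Perm (Fin m),
      ∏ i : Fin m, d (Fin.ofNat j ((σ i : Fin m) : ℕ) + Fin.ofNat j (i : ℕ)) = 1) :
    linSubst (Fin j) ℂ (Matrix.diagonal d)
        (MvPolynomial.rename
          (fun ik : Fin m × Fin m => Fin.ofNat j (ik.1 : ℕ) + Fin.ofNat j (ik.2 : ℕ))
          (perPoly (Fin m) ℂ)) =
      MvPolynomial.rename
        (fun ik : Fin m × Fin m => Fin.ofNat j (ik.1 : ℕ) + Fin.ofNat j (ik.2 : ℕ))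
        (perPoly (Fin m) ℂ) := by
  classical
  rw [modCollapse_eq_sum, map_sum]
  refine Finset.sum_congr rfl fun σ _ => ?_
  rw [prod_X_eq_monomial_sum_single_mod, linSubst_diagonal_monomial]
  have hprod : ((∑ i : Fin m,
      Finsupp.single (Fin.ofNat j ((σ i : Fin m) : ℕ) + Fin.ofNat j (i : ℕ)) 1).prod
        fun x n => d x ^ n) = 1 := by
    rw [← hd σ, ← Finsupp.prod_finsetSum_index (fun _ => pow_zero _) (fun _ _ _ => pow_add _ _ _)]
    refine Finset.prod_congr rfl fun i _ => ?_
    rw [Finsupp.prod_single_index (h := fun x n => d x ^ n) (pow_zero _), pow_one]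
  rw [hprod, one_smul]

/-! ### 2. The index-sum congruence and the separating torus -/

/-- **Index-sum congruence.** For every permutation `σ` of `Fin m`, the residues
`(σ i + i) mod j` have total `∑_i ((σ i + i) mod j) ≡ m(m-1) (mod j)`: indeed
`∑_i (σ i + i) = 2 · (0 + 1 + ⋯ + (m-1)) = m(m-1)`. [folklore] -/
theorem sum_val_label_modEq (σ : Equiv.Perm (Fin m)) :
    (∑ i : Fin m, ((Fin.ofNat j ((σ i : Fin m) : ℕ) + Fin.ofNat j (i : ℕ) : Fin j) : ℕ)) ≡
      m * (m - 1) [MOD j] := by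
  have hsum : ∑ i : Fin m, (((σ i : Fin m) : ℕ) + (i : ℕ)) = m * (m - 1) := by
    rw [Finset.sum_add_distrib, Equiv.sum_comp σ (fun i : Fin m => (i : ℕ)), ← mul_two,
      Fin.sum_univ_eq_sum_range (fun i => i) m, Finset.sum_range_id_mul_two]
  unfold Nat.ModEq
  rw [← hsum, Finset.sum_nat_mod, Finset.sum_nat_mod (Finset.univ) j (fun i : Fin m => _ + _)]
  congr 1
  refine Finset.sum_congr rfl fun i _ => ?_
  rw [Fin.val_add, Fin.val_ofNat, Fin.val_ofNat, Nat.mod_mod, ← Nat.add_mod]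

/-- **Separating diagonal stabilizers of the modular collapse** (hypothesis 1' of the corrected
BI 2017 Prop. 2.8). Let `ζ = e^{2πi/j}`; the diagonal substitution `d_r = ζ^r · (ζ^{m-1})⁻¹`
FIXES `Q_{m,j}` — each monomial is multiplied by `ζ^{∑_i ((σ i + i) mod j)} · ζ^{-m(m-1)} = 1`
by the index-sum congruence — and `d_r ≠ d_{r'}` for `r ≠ r'` since `ζ` is a primitive `j`-th
root of unity. [cite: BurgisserIkenmeyer2017, Prop. 2.8 and Cor. 2.9 (proof)] -/
theorem modCollapse_separating (x x' : Fin j) (hxx : x ≠ x') :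
    ∃ d : Fin j → ℂ,
      linSubst (Fin j) ℂ (Matrix.diagonal d)
          (MvPolynomial.rename
            (fun ik : Fin m × Fin m => Fin.ofNat j (ik.1 : ℕ) + Fin.ofNat j (ik.2 : ℕ))
            (perPoly (Fin m) ℂ)) =
        MvPolynomial.rename
          (fun ik : Fin m × Fin m => Fin.ofNat j (ik.1 : ℕ) + Fin.ofNat j (ik.2 : ℕ))
          (perPoly (Fin m) ℂ) ∧
      d x ≠ d x' := by
  classical
  have hj0 : j ≠ 0 := NeZero.ne j
  set ζ : ℂ := Complex.exp (2 * Real.pi * Complex.I / j) with hζdef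
  have hζ : IsPrimitiveRoot ζ j := Complex.isPrimitiveRoot_exp j hj0
  have hζ0 : ζ ≠ 0 := hζ.ne_zero hj0
  have hη0 : ζ ^ (m - 1) ≠ 0 := pow_ne_zero _ hζ0
  refine ⟨fun r => ζ ^ (r : ℕ) * (ζ ^ (m - 1))⁻¹, ?_, ?_⟩
  · apply linSubst_diagonal_modCollapse_eq
    intro σ
    rw [Finset.prod_mul_distrib, Finset.prod_pow_eq_pow_sum, Finset.prod_const, Finset.card_univ,
      Fintype.card_fin]
    have hpow : ζ ^ (∑ i : Fin m, ((Fin.ofNat j ((σ i : Fin m) : ℕ) + Fin.ofNat j (i : ℕ) : Fin j) : ℕ)) =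
        ζ ^ (m * (m - 1)) := by
      rw [pow_eq_pow_mod _ hζ.pow_eq_one, sum_val_label_modEq σ, ← pow_eq_pow_mod _ hζ.pow_eq_one]
    rw [hpow, inv_pow, ← pow_mul, mul_comm (m - 1) m]
    exact mul_inv_cancel₀ (pow_ne_zero _ hζ0)
  · intro h
    apply hxx
    have h' : ζ ^ (x : ℕ) = ζ ^ (x' : ℕ) := mul_right_cancel₀ (inv_ne_zero hη0) h
    exact Fin.ext (hζ.pow_inj x.isLt x'.isLt h')

end ModCollapse

end Summit.ValiantsHypothesis.ValiantsHypothesis.Theorems.GeneratorObstructions.PerGenDegreeSuperQP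

end
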